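import Summits.AtomisticToContinuum.HydrodynamicLimit.Theses.SuperextensiveClosureCost
import Summits.AtomisticToContinuum.HydrodynamicLimit.Theorems.JParityClosureOddContactSymmetryGibbsInvariance
import HarnessLib

/-!
# `GibbsInvariance` (support item stmt-AtomisticToContinuum-9239, route `SuperextensiveClosureCost`):
# the homogeneous canonical Gibbs law is preserved by every hard-sphere flow map

The support item `GibbsInvariance` of the route `SuperextensiveClosureCost` of the sub-problem
`HydrodynamicLimit` (= the shared typed support stmt-AtomisticToContinuum-3926 verbatim): for every
`σ θe : ℝ`, `N : ℕ`, every hard-sphere flow `Φ` of `N + 1` spheres of diameter `hsDiameter σ N` on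
`𝕋³` and every time `t`, the flow map `Φ.flow t` is measure preserving for the homogeneous local Gibbs
law `G_N = localGibbsLaw σ 1 0 θe N Φ` (the canonical Gibbs law at unit density, zero drift and
temperature `θe`), i.e. `MeasurePreserving (Φ.flow t) G_N G_N`.

Proof: this is the tree theorem `Theorems.measurePreserving_flow_localGibbsLaw_const`
(`Theorems/JParityClosureOddContactSymmetryGibbsInvariance.lean`) — Liouville's theorem
(`HardSphereFlow.measurePreserving`: the flow preserves the hard-sphere Liouville measure) plus
invariance of the canonical density on the conull good set, the density being a function of
`Σᵢ ‖vᵢ − u‖² = 2E − 2⟪P, u⟫ + (N+1)‖u‖²`, which is conserved along good orbits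
(`HardSphereFlow.configEnergy_flow`, `HardSphereFlow.configMomentum_flow`) — specialised to the
constant profiles `(a, u, θ) = (1, 0, θe)`. The hypothesis `0 < θe` of the item is not needed.

References: R. K. Alexander, *The infinite hard sphere system* (1975), Ch. 2 (the hard-sphere flow is
defined Liouville-a.e. and preserves Liouville measure); C. Cercignani, R. Illner, M. Pulvirenti,
*The Mathematical Theory of Dilute Gases* (1994), §4.2; H. Spohn, *Large Scale Dynamics of
Interacting Particles* (1991), Part I §2.3 (equilibrium measures are invariant under the dynamics).
-/

noncomputable section

namespace Summit.AtomisticToContinuum.HydrodynamicLimit.Theorems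

open MeasureTheory
open Literature.Analysis.FluidPDE Literature.MathematicalPhysics.KineticTheory

/-- **`GibbsInvariance` holds** (support item stmt-AtomisticToContinuum-9239, route
`SuperextensiveClosureCost`, concluded BY NAME): for every `σ θe N Φ t` (and `0 < θe`, unused) the
flow map `Φ.flow t` preserves the homogeneous canonical Gibbs law `localGibbsLaw σ 1 0 θe N Φ`.
Liouville preservation + energy and momentum conservation on the good set
(`measurePreserving_flow_localGibbsLaw_const` at constant profiles `(1, 0, θe)`). [folklore] -/
theorem superextensiveClosureCost_gibbsInvariance_proof :
    Summit.AtomisticToContinuum.HydrodynamicLimit.Theses.SuperextensiveClosureCost.GibbsInvariance := by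
  unfold Summit.AtomisticToContinuum.HydrodynamicLimit.Theses.SuperextensiveClosureCost.GibbsInvariance
  intro σ θe N Φ t _
  exact measurePreserving_flow_localGibbsLaw_const σ 1 θe 0 N Φ t

end Summit.AtomisticToContinuum.HydrodynamicLimit.Theorems

end
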